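import Summits.CriticalPhenomena.SAWScalingLimit.Theses.SAWTrackTransport
import Literature.Probability.RandomPlanarGeometry.SAWScalingLimitFamily
import Summits.CriticalPhenomena.SAWScalingLimit.Theorems.SubseqIdentification.Negative.ProbabilityRedundant

/-!
# `YBtoUniform` (stmt-CriticalPhenomena-16966): the Yang–Baxter endpoint hypothesis is load-bearing

Refuter crux-attack (vetting cycle 1), hypothesis mutation for the crux
`Summit.CriticalPhenomena.SAWScalingLimit.Theses.SAWTrackTransport.YBtoUniform`.
Dropping the hypothesis `IsYBEndpointApprox (π/2) D a' b'` makes the statement false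
(`ybtoUniform_false_without_ybApprox`, whose type is literally `¬ (YBtoUniform with that binder
removed)`): with the constant mid-edge family `a' = b' ≡ origin` every Yang–Baxter walk from
`origin` to `origin` is drawn from `δ · planeMidpoint origin = 0`, so the bounded continuous test
function `γ ↦ min 1 ‖γ.source‖` integrates to `0` on the Yang–Baxter side for EVERY `δ`, whereas
on the `δℤ²` side (unit disc `(𝔻; 1, -1)`, any endpoint approximation, laws eventually probability
measures) it tends to `min 1 ‖pt 0‖ = 1`.
No scaling-limit input is used: the lemma only records that any proof of the crux must use the
convergence `δ · planeMidpoint (a' δ) → pt 0` (resp. `→ pt 1`) of the Yang–Baxter endpoints — the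
two endpoint approximations are the only link between the two laws in the statement. (The
converse weakening `(mutated statement) → YBtoUniform` is the trivial
`fun h D a b a' b' hab _ f => h D a b a' b' hab f`.)
Also recorded: the two `source` computations `source_curve_domainSAW`, `source_curve_ybWalk`
(every drawn walk starts at its rescaled first lattice point), reusable with any test function
of the form `g ∘ CurveClass.source`.
-/

noncomputable section

namespace Summit.CriticalPhenomena.SAWScalingLimit.Theorems.YBtoUniform.Negative

open MeasureTheory Filter Topology
open Literature.Probability.RandomPlanarGeometry Literature.Probability.RandomPlanarGeometry.SAW.YangBaxter
open Literature.Probability.LatticeModels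

/-- Every `δℤ²` SAW curve of `Ω_δ` from `a` to `b` starts at the mesh point `δ a`. [folklore] -/
theorem source_curve_domainSAW {Ω : Set ℂ} {δ : ℝ} {a b : Site 2} (γ : SAW.DomainSAW Ω δ a b) :
    γ.curve.source = meshPoint δ a := by
  show (γ.walk.toCurve (meshPoint δ)) 0 = meshPoint δ a
  exact SimpleGraph.Walk.toCurve_apply_zero _ _

/-- Every Yang–Baxter curve of `Ω_δ` from `a` to `b`, drawn at mesh `δ`, starts at
`δ · planeMidpoint Θ a`. [folklore] -/
theorem source_curve_ybWalk {Θ : ℤ → ℝ} {Ω : Set ℂ} {δ : ℝ} {a b : MidEdge}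
    (γ : YangBaxterSAW Θ Ω δ a b) : (γ.curve Θ δ).source = (δ : ℂ) * planeMidpoint Θ a := by
  show (γ.path Θ δ) 0 = (δ : ℂ) * planeMidpoint Θ a
  exact YBWalk.path_apply_zero γ

/-- **`IsYBEndpointApprox` is load-bearing in `YBtoUniform`**: the crux
`SAWTrackTransport.YBtoUniform` with the binder `IsYBEndpointApprox (fun _ => π/2) D a' b' →`
deleted (everything else verbatim) is FALSE. Witness: `D = (𝔻; 1, -1)`, any `δℤ²` endpoint
approximation (`SAW.exists_isEndpointApprox`), `a' = b' ≡ origin`, `f = min 1 ‖source‖`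
(`CurveClass.source` is `1`-Lipschitz); the difference of test integrals tends to `1`, not `0`.
[folklore] -/
theorem ybtoUniform_false_without_ybApprox :
    ¬ (∀ (D : DobrushinDomain) (a b : ℝ → Site 2) (a' b' : ℝ → MidEdge), SAW.IsEndpointApprox D a b →
        ∀ f : BoundedContinuousFunction (CurveClass ℂ) ℝ,
          Tendsto (fun δ : ℝ => (∫ γ, f γ.curve ∂(SAW.law D.carrier δ (a δ) (b δ))) -
            ∫ γ, f (γ.curve (fun (_ : ℤ) => Real.pi / 2) δ)
              ∂(ybLaw (fun (_ : ℤ) => Real.pi / 2) D.carrier δ 1 (a' δ) (b' δ)))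
            (𝓝[>] (0 : ℝ)) (𝓝 0)) := by
  intro h
  -- the test function `γ ↦ min 1 ‖γ.source‖`
  set F : BoundedContinuousFunction (CurveClass ℂ) ℝ :=
    BoundedContinuousFunction.mkOfBound
      ⟨fun γ => min 1 ‖γ.source‖,
        continuous_const.min (continuous_norm.comp CurveClass.continuous_source)⟩
      1 (fun γ₁ γ₂ => by
        simp only [ContinuousMap.coe_mk, Real.dist_eq]
        have h1 : 0 ≤ min 1 ‖γ₁.source‖ := le_min zero_le_one (norm_nonneg _)
        have h2 : 0 ≤ min 1 ‖γ₂.source‖ := le_min zero_le_one (norm_nonneg _)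
        have h3 : min 1 ‖γ₁.source‖ ≤ 1 := min_le_left _ _
        have h4 : min 1 ‖γ₂.source‖ ≤ 1 := min_le_left _ _
        rw [abs_le]; constructor <;> linarith) with hF_def
  have hF : ∀ γ : CurveClass ℂ, F γ = min 1 ‖γ.source‖ := fun γ => rfl
  obtain ⟨a, b, hab⟩ := SAW.exists_isEndpointApprox DobrushinDomain.unitDisc
  have key := h DobrushinDomain.unitDisc a b (fun _ => origin) (fun _ => origin) hab F
  -- the Yang–Baxter side vanishes identically: every walk from `origin` is drawn from `0`
  have hYB : ∀ δ : ℝ,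
      ∫ γ, F (γ.curve (fun (_ : ℤ) => Real.pi / 2) δ)
        ∂(ybLaw (fun (_ : ℤ) => Real.pi / 2) DobrushinDomain.unitDisc.carrier δ 1 origin origin) = 0 := by
    intro δ
    have hzero : ∀ γ : YangBaxterSAW (fun (_ : ℤ) => Real.pi / 2)
        DobrushinDomain.unitDisc.carrier δ origin origin,
        F (γ.curve (fun (_ : ℤ) => Real.pi / 2) δ) = 0 := by
      intro γ
      rw [hF, source_curve_ybWalk, planeMidpoint_origin, mul_zero, norm_zero]
      simp
    simp [hzero]
  -- the `δℤ²` side is eventually `min 1 ‖δ a_δ‖` (laws eventually probability measures)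
  have hSAW : ∀ᶠ δ in 𝓝[>] (0 : ℝ),
      ∫ γ, F γ.curve ∂(SAW.law DobrushinDomain.unitDisc.carrier δ (a δ) (b δ)) =
        min 1 ‖meshPoint δ (a δ)‖ := by
    filter_upwards [Summit.CriticalPhenomena.SAWScalingLimit.Theorems.SubseqIdentification.Negative.eventually_isProbabilityMeasure_law hab] with δ hP
    have hconst : ∀ γ : SAW.DomainSAW DobrushinDomain.unitDisc.carrier δ (a δ) (b δ),
        F γ.curve = min 1 ‖meshPoint δ (a δ)‖ := by
      intro γ
      rw [hF, source_curve_domainSAW]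
    simp [hconst]
  -- the first marked point of `(𝔻; 1, -1)` is `1`
  have hpt : DobrushinDomain.unitDisc.pt 0 = 1 := by
    show circleMap 0 1 (2 * Real.pi * ((![0, 1 / 2] : Fin 2 → ℝ) 0)) = 1
    simp [circleMap]
  -- hence the difference tends to `min 1 ‖pt 0‖ = 1`
  have hlim : Tendsto (fun δ : ℝ => min 1 ‖meshPoint δ (a δ)‖) (𝓝[>] (0 : ℝ))
      (𝓝 (min 1 ‖DobrushinDomain.unitDisc.pt 0‖)) :=
    ((continuous_const.min continuous_norm).tendsto _).comp hab.tendsto_fst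
  rw [hpt, norm_one, min_self] at hlim
  have hlim' : Tendsto (fun δ : ℝ =>
      (∫ γ, F γ.curve ∂(SAW.law DobrushinDomain.unitDisc.carrier δ (a δ) (b δ))) -
        ∫ γ, F (γ.curve (fun (_ : ℤ) => Real.pi / 2) δ)
          ∂(ybLaw (fun (_ : ℤ) => Real.pi / 2) DobrushinDomain.unitDisc.carrier δ 1
            ((fun _ : ℝ => origin) δ) ((fun _ : ℝ => origin) δ)))
      (𝓝[>] (0 : ℝ)) (𝓝 1) := by
    refine hlim.congr' ?_
    filter_upwards [hSAW] with δ hδ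
    rw [hδ, hYB, sub_zero]
  exact one_ne_zero (tendsto_nhds_unique hlim' key)

end Summit.CriticalPhenomena.SAWScalingLimit.Theorems.YBtoUniform.Negative
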